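import Mathlib
import Literature.MathematicalPhysics.QuantumFieldTheory.Balaban1983to89.B14Thm2
import Literature.MathematicalPhysics.QuantumFieldTheory.Balaban1983to89.B14DomainGeom

/-!
# `Balaban1983to89.B14Seam245` — [Balaban1988Convergent] (2.45) p. 263 WITH THE SEAM TERM of (3.65)/(3.67):
# the printed summation "(2.43) at Ω = Bʲ(Λ_j⁰), φ = φ_j, summed over j" kernel-checked when (2.43) is available
# only for the tent sum φ_Ω = Σ_{z∈Λ_j⁰} h_z

CITATION HEADER (lean-in-tree rule 2026-08-18).  Source: T. Bałaban, *Convergent renormalization expansions for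
lattice gauge theories*, Commun. Math. Phys. **119**, 243–285 (1988), doi:10.1007/bf01217741 (cell paper B14, bib key
`Balaban1988Convergent`; journal page = PDF page + 242; quotations read from the page renders p011 = p. 253,
p017 = p. 259, p021 = p. 263, p041 = p. 283); secondary: T. Bałaban, *The variational problem and background fields in
renormalization group method for lattice gauge theories*, Commun. Math. Phys. **102**, 277–309 (1985) (cell paper
B11, bib key `Balaban1985Variational`; render p002 = p. 278).

THE PRINTED TEXT.  p. 259 (2.25): *"𝐄_k(U_k) = Σ_{j=1}^{k} [𝐄^{(j)}(Λ_j, g_{j−1}, U_k) − 𝐄^{(j)}(Λ_j, g_{j−1}, 1) −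
β_j(g_{j−1})A(φ_j, U_k)]"*, with (2.24) *"φ_j ∈ C₀^∞(Λ_j), φ_j = 1 on Λ_j^{~−1}"* and *"Let us denote by Λ_j⁰ the
set which is obtained by removing one layer of the MR_j-cubes from Λ_j^{(j)} ⊂ T₁^{(j)}"*; p. 253: *"The symbol
A(φ₁, U₁) means that we multiply the term in the Wilson action corresponding to a plaquette p by φ₁(x(p)), x(p) is
the initial point of ∂p [i.e., p = p_{μν}(x) for some μ < ν]"* (B11 (5) p. 278: *"A(U) = A^η(U) = Σ_{p⊂Ω₀}
η^{d−4}[1 − Re tr U(∂p)], η = L^{−k}"*; B11 (2) p. 278: *"|U(∂p) − 1| = |(∂U)(p) − 1| < ε₀L^{−2j} = ε₀η²(Lʲη)^{−2}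
for p ∈ Ω_j, j = 0, 1, …, k"*); p. 263 (2.45): *"Taking Ω = Bʲ(Λ_j⁰), φ = φ_j in (2.43), and summing the obtained
inequalities over j, we get |𝐄_k(U_k)| ≤ E₁ Σ_{n=1}^{k} |Γ_n| Σ_{j=1}^{n} (L^{j−n})^β < E₁(1 − L^{−β})^{−1}
Σ_{n=1}^{k} |Γ_n|"*; p. 283 (3.65): *"A(φ_j, U_k) = Σ_{z∈T^{(j)}} A(h_zφ_j, U_k), where h_z is defined as in
(3.40), but on the lattice T_{L^{−j}}, and with h(t) = max{1 − |t|, 0}. For z ∈ Λ_j⁰ we have h_zφ_j = h_z"*, and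
after (3.67): *"Summing over z ∈ Λ_j⁰∩Ω w[e] get the inequality (2.43) in Theorem 2"*.

WHAT IS AT ISSUE (LOCATED in the cell, GAPS.md rows G-adv6-1 / C-ref2-1 / C-adv6-6 / G-ref2-5 / C-B14s-05; not
adjudicated here).  The pointwise statement (3.67) carries the tent `h_z`, `z ∈ Λ_j⁰`; summing it over `z ∈ Λ_j⁰ ∩ Ω`
produces the bracket of (2.43) with the weight `φ_Ω := Σ_{z∈Λ_j⁰∩Ω} h_z` — which agrees with `φ_j` only where every
tent comes from `Λ_j⁰` — in place of `φ_j`.  Since `A(·, U)` is linear in its weight (p. 253), the j-th summand `e_j`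
of (2.25) differs from that bracket `T_j` by `β_j(g_{j−1})·A(φ_j − φ_Ω, U_k)`, a term supported in the unit
neighbourhood of `Λ_j ∖ Λ_j⁰` (the *seam*), which by (3.5) p. 265 + (2.9) p. 256 lies in `Γ_j = Ω_j ∖ Ω_{j+1}`
(sibling module `B14DomainGeom`, `disjoint_seam_omega35`).  CUBE CARRIER (v3; cell GAPS.md G-adv6-13): the removed
layer is one layer of the cubes of `Λ_j`'s OWN partition — `MR_j`-cubes for the domains p. 256 calls *"determined by
the j-th renormalization transformation, but not by the 𝐑-operation"*, M-cubes for 𝐑-produced ones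
([Balaban1989LargeFieldI] p. 179: *"unions of M-cubes of the lattice T_η"*; p. 255 here: *"we admit the possibility
that Λ_j = Ω_j for some indices j. Such a situation may arise as a result of an 𝐑-operation"*).  Everything below is
parametric in that side: §A counts seam POINTS whatever the width, §B's certified inclusion holds for the M-carrier with
no use of (2.9) (`seam_count_le_omega35_Mcubes`, instance `R_k := 1`), and the count `|S ∩ Λ_j| ≤ |Γ_j|` of row
C-adv6-6 (iv) is unchanged (the seam is thinner: width `M` instead of `MR_j`).  The cell's repair (row C-adv6-6 (iii)–(iv)) bounds the
seam term by `3c²ε_j²|Γ_j|` per scale and concludes the printed SHAPE of (2.45) with the constant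
`E₁(1 − L^{−β})^{−1} + 3c²β′ε_max²`.

WHAT IS REPRODUCED HERE (bookkeeping only; every analytic input is an explicit hypothesis):
* §A the weighted action as a finite sum `weightedAction plaq x w ψ = Σ_p ψ(x p)·w p` (p. 253), its linearity in
  the weight (`weightedAction_sub`) and the SEAM ESTIMATE `weightedAction_seam_le`: a weight `0 ≤ ψ ≤ 1` supported in
  a finite point set `S`, plaquette terms `0 ≤ w ≤ b` over `S`, at most `m` plaquettes per initial point ⟹
  `0 ≤ A(ψ,U) ≤ b·m·|S|`; with `m = 6 = d(d−1)/2` (d = 4), `b = ½c²ε_j²(a_η/a_j)⁴`, `|S| = (a_j/a_η)⁴|S|_j` this is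
  the cell's `3c²ε_j²|S|_j` (`seam_value`);
* §B the counting step behind `|S ∩ Λ_j| ≤ |Γ_j|`: monotonicity of a point count under the CERTIFIED set inclusion
  `seam ∩ Λ_j ⊆ Ω_j ∖ Ω_{j+1}` of `B14DomainGeom` (`seam_count_le`, `seam_count_le_omega35`);
* §C the per-scale triangle inequality `|e_j| ≤ |T_j| + |β_j|·A(φ_j − φ_Ω, U_k)` and its numeric consequence
  `|e_j| ≤ E₁Σ_{n=j}^{k}(L^{j−n})^β|Γ_n| + 3c²β′ε_max²|Γ_j|` (`perScale_seam`, `perScale_seam_bound`);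
* §D the ABSORPTION of a per-scale term `C_s|Γ_j|` into the (2.43) shape (`h243_of_seam`: `E₁ ↦ E₁ + C_s`, because
  the `n = j` member of `Σ_{n=j}^{k}(L^{j−n})^β|Γ_n|` is `|Γ_j|`), so that the sibling module's
  `B14Thm2.bound245_of_243`, `bounds245to249_of_perScale`, `ineq249_of_perScale` apply VERBATIM with `E₁ + C_s`
  (`bound245_seam_absorbed`), and the sharper direct summation `bound245_seam`:
  `|Σ_j e_j| ≤ (E₁(1 − L^{−β})^{−1} + C_s) Σ_n |Γ_n|` — the constant of row C-adv6-6 (iv) with `C_s = 3c²β′ε_max²`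
  (`constant_shape`: equivalently E₁ replaced by `E₁ + C_s(1 − L^{−β})` inside the printed (2.45)); assembled from
  the per-scale data in `ineq245_seam`;
* §E (v4) the same assembly SIGN-FREE: `|A(φ_j − φ_Ω, U)| ≤ 3c²ε_j²|S|_j` from `supp(φ_j − φ_Ω) ⊆ seam`, `|φ_j − φ_Ω| ≤ 1`
  (`diff_eq_zero_off_seam`, `abs_diff_le_one`, `weightedAction_abs_seam_le`) and `|e_j| ≤ |T_j| + |β_j|·|D_j|`, giving
  `ineq245_seam_abs` with the same constant — p. 283's *"h_zφ_j = h_z"* (hypothesis `hΛ0` of §D v2) is not used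
  (cell GAPS.md G-adv6-20).
WHAT IS *NOT* REPRODUCED OR ASSERTED: (2.43)/(3.67) themselves (hypothesis `hT`); the plaquette regularity
`|U_k(∂p) − 1| < cε_j(a_η/a_j)²` on the seam plaquettes — B11 (2) is the single-ε₀ form quoted above, the multi-scale
`ε_j` form is B14's standing *"sufficiently regular configurations U_k"* (cell GAPS G-adv6-4) — and the elementary
`1 − Re tr U ≤ ½|U − 1|²`: together they are the hypothesis `hwb`; `|β_j| ≤ β′` — HYPOTHESIS: `β′` is the
constant printed in (2.6) p. 255 (*"The coupling constants g_j satisfy the inequalities g_n ≤ (1 + g_n²β′(n − m))^{1/2}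
g_m ≤ …"*, *"The inequalities follow from the renormalization group equations (0.20) [I], and from the properties
of the β-functions"*); B14 does not display `|β_j| ≤ β′` — it is this module's name for the uniform bound on the
β-functions of [I] (v2 precision, cell journal NOTE pv21 → pv02 2026-08-18T17:43Z); `ε_j ≤ ε_max`; the
identification of `|Γ_n|` with a point count.  Nothing of the series is asserted; value = kernel bookkeeping of a
located repair, NOT summit progress.  Unit `b2b-balaban-pv02` gen 2 (journal claim P14-adv6a-ii); companion rows:
cell `GAPS.md` C-B14s-06 (this module), C-B14s-05, C-adv6-6, G-adv6-1, C-ref2-1, G-ref2-5; `DIVERGENCE.md` D-pv02.13.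
Revision v3 (gen 3): the CUBE CARRIER note above and the corollary `seam_count_le_omega35_Mcubes` (G-adv6-13); no
existing declaration changed.  Revision v4 (gen 4, cell GAPS.md G-adv6-20, adversarial reader adv6 gen 8): p. 283's *"For
z ∈ Λ_j⁰ we have h_zφ_j = h_z"* is a PRINTED SENTENCE whose derivation from (2.24) + p. 259 depends on the (unprinted)
cube family of the operation `∼` in (2.24) — see §E; §D (v2) carries it as the hypothesis `hΛ0` and uses it only
for the SIGN of the seam term; the new §E proves the same (2.45)-with-seam bound, same constant, WITHOUT it
(`ineq245_seam_abs`; support of `φ_j − φ_Ω` in the seam from (2.24) as printed + (3.40), `|φ_j − φ_Ω| ≤ 1`), types adv6's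
repair (a) as a one-line lemma, and re-derives `ineq245_seam` as a corollary; docstrings of `weight_diff_nonneg` /
`action_diff_nonneg` / §D (v2) amended accordingly; no existing declaration's statement or proof changed.  Revision v4.1
(gen 4, cell GAPS.md G-pv13g3-2, cross-reader `b2b-balaban-pv13` gen 3): DOCSTRING-ONLY precision — v4's clauses
*"`Λ_j^{∼−1} = Λ_j⁰` exactly"* and *"`R_j ≥ 2`, equally unprinted"* overstated the print: p. 259 does not name the cube
family of `∼` in (2.24); under the `MR_j`-cube reading (the one of cell row G-adv6-20) `Λ_j^{∼−1} = Λ_j⁰` and the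
sentence is not derivable, under [Balaban1987RG1] p. 257's `M`-cube family `π_j` (B14 names its deviations explicitly,
p. 256 [PDF 14] *"where the operation ∼ is taken for M₁-cubes"*; p. 263's clause fixes the scale) `Λ_j^{∼−1} ⊋ Λ_j⁰` and
the sentence FOLLOWS from (2.24) once `2M + 1 ≤ MR_j`, i.e. `R_j ≥ 3`, which (2.5) p. 255 [PDF 13] (*"R_j is the smallest
number of the form L^r such, that R_j ≥ (log g_j⁻²)^r."*) gives for `g_j` small (renders p013, p014, p021 and
1987-cmp109 p009 re-read); the kernel (every statement and proof) is untouched and reading-independent.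
-/

namespace Literature.MathematicalPhysics.QuantumFieldTheory.Balaban1983to89.B14Seam245

open Literature.MathematicalPhysics.QuantumFieldTheory.Balaban1983to89

/-! ## A. The weighted Wilson action as a finite sum; linearity; the seam estimate -/

variable {P X : Type*}

/-- p. 253: *"The symbol A(φ₁, U₁) means that we multiply the term in the Wilson action corresponding to a plaquette
p by φ₁(x(p)), x(p) is the initial point of ∂p"* — `A(ψ, U) = Σ_{p ∈ plaq} ψ(x p) · w p`, where `w p` is the term
of the Wilson action of the plaquette `p` at the fixed configuration `U` (B11 (5): `η^{d−4}[1 − Re tr U(∂p)]`) and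
`x p` its initial point. [cite: Balaban1988Convergent, p.253; Balaban1985Variational, (5) p.278] -/
def weightedAction (plaq : Finset P) (x : P → X) (w : P → ℝ) (ψ : X → ℝ) : ℝ :=
  ∑ p ∈ plaq, ψ (x p) * w p

/-- `A(·, U)` is linear in the weight: `A(φ, U) − A(φ′, U) = A(φ − φ′, U)`. [cite: Balaban1988Convergent, p.253] -/
theorem weightedAction_sub (plaq : Finset P) (x : P → X) (w : P → ℝ) (φ φ' : X → ℝ) :
    weightedAction plaq x w φ - weightedAction plaq x w φ' = weightedAction plaq x w (φ - φ') := by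
  unfold weightedAction
  rw [← Finset.sum_sub_distrib]
  refine Finset.sum_congr rfl fun p _ => ?_
  simp only [Pi.sub_apply, sub_mul]

/-- A non-negative weight against non-negative plaquette terms gives `A(ψ, U) ≥ 0`. [folklore] -/
theorem weightedAction_nonneg (plaq : Finset P) (x : P → X) (w : P → ℝ) (ψ : X → ℝ)
    (hψ : ∀ y, 0 ≤ ψ y) (hw : ∀ p ∈ plaq, 0 ≤ w p) : 0 ≤ weightedAction plaq x w ψ :=
  Finset.sum_nonneg fun p hp => mul_nonneg (hψ _) (hw p hp)

/-- **The seam estimate** (cell GAPS C-adv6-6 (iii), bookkeeping part): a weight `ψ ≤ 1` supported in the finite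
point set `S` (non-negativity of `ψ` is not needed for the upper bound), plaquette terms `0 ≤ w p` everywhere and
`w p ≤ b` whenever `x p ∈ S`, and at most `m` plaquettes with a given initial point in `S`, give
`A(ψ, U) ≤ b · m · |S|`.  (In the cell's use: `ψ = φ_j − φ_Ω`, `S` = the fine-lattice
points of the seam, `m = 6`, `b = ½c²ε_j²(a_η/a_j)⁴` from `1 − Re tr U ≤ ½|U − 1|²` and the assumed regularity
`|U_k(∂p) − 1| < cε_j(a_η/a_j)²` — the latter two are NOT proved here, they are what `hwb` says.)
[cite: Balaban1988Convergent, p.253, (3.65) p.283; Balaban1985Variational, (2) p.278] -/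
theorem weightedAction_seam_le [DecidableEq X] (plaq : Finset P) (x : P → X) (w : P → ℝ) (ψ : X → ℝ)
    (S : Finset X) (b : ℝ) (m : ℕ) (hb : 0 ≤ b)
    (hψ1 : ∀ y, ψ y ≤ 1) (hψS : ∀ y, y ∉ S → ψ y = 0)
    (hw0 : ∀ p ∈ plaq, 0 ≤ w p) (hwb : ∀ p ∈ plaq, x p ∈ S → w p ≤ b)
    (hm : ∀ y ∈ S, ((plaq.filter fun p => x p = y).card : ℝ) ≤ m) :
    weightedAction plaq x w ψ ≤ b * m * S.card := by
  classical
  set F := plaq.filter fun p => x p ∈ S with hF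
  have hsplit : weightedAction plaq x w ψ = ∑ p ∈ F, ψ (x p) * w p := by
    unfold weightedAction
    rw [hF, Finset.sum_filter_of_ne]
    intro p _ hne
    by_contra hS
    exact hne (by rw [hψS _ hS, zero_mul])
  have hterm : ∀ p ∈ F, ψ (x p) * w p ≤ b := by
    intro p hp
    rw [hF, Finset.mem_filter] at hp
    calc ψ (x p) * w p ≤ 1 * w p := mul_le_mul_of_nonneg_right (hψ1 _) (hw0 p hp.1)
      _ = w p := one_mul _
      _ ≤ b := hwb p hp.1 hp.2
  have hcount : (F.card : ℝ) ≤ m * S.card := by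
    have h1 : F.card = ∑ y ∈ S, (F.filter fun p => x p = y).card :=
      Finset.card_eq_sum_card_fiberwise fun p hp => by
        have hp' : p ∈ F := by simpa using hp
        rw [hF, Finset.mem_filter] at hp'
        simpa using hp'.2
    have h2 : ∀ y ∈ S, ((F.filter fun p => x p = y).card : ℝ) ≤ m := by
      intro y hy
      refine le_trans ?_ (hm y hy)
      exact_mod_cast Finset.card_le_card fun p hp => by
        simp only [hF, Finset.mem_filter] at hp ⊢
        exact ⟨hp.1.1, hp.2⟩
    calc (F.card : ℝ) = ∑ y ∈ S, ((F.filter fun p => x p = y).card : ℝ) := by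
          rw [h1]; push_cast; rfl
      _ ≤ ∑ _y ∈ S, (m : ℝ) := Finset.sum_le_sum h2
      _ = m * S.card := by rw [Finset.sum_const, nsmul_eq_mul]; ring
  calc weightedAction plaq x w ψ = ∑ p ∈ F, ψ (x p) * w p := hsplit
    _ ≤ ∑ _p ∈ F, b := Finset.sum_le_sum hterm
    _ = b * F.card := by rw [Finset.sum_const, nsmul_eq_mul]; ring
    _ ≤ b * (m * S.card) := mul_le_mul_of_nonneg_left hcount hb
    _ = b * m * S.card := by ring

/-- The cell's number (GAPS C-adv6-6 (iii)): with `b = ½c²ε²N⁻¹` per fine plaquette (`N = (a_j/a_η)⁴` fine points per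
j-scale point, so `(a_η/a_j)⁴ = N⁻¹`), `m = 6` plaquettes per initial point (`d = 4`) and `|S| = N·|S|_j` fine points,
`b·m·|S| = 3c²ε²|S|_j`. [folklore] -/
theorem seam_value (c ε N Sj : ℝ) (hN : N ≠ 0) :
    (1 / 2 * c ^ 2 * ε ^ 2 * N⁻¹) * 6 * (N * Sj) = 3 * c ^ 2 * ε ^ 2 * Sj := by
  field_simp
  ring

/-! ## B. The counting step `|seam ∩ Λ_j| ≤ |Γ_j|` from the certified set inclusion -/

/-- Point counts are monotone under the set inclusion `S ∩ Λ_j ⊆ Ω_j ∖ Ω_{j+1}` (`B14DomainGeom.seam_inter_subset_sdiff`: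
(2.1) `Λ_j ⊆ Ω_j` and `S ∩ Ω_{j+1} = ∅`): for every finite counting set `P` of lattice points (e.g. the points of one
scale), `|P ∩ S ∩ Λ_j| ≤ |P ∩ (Ω_j ∖ Ω_{j+1})|`. [cite: Balaban1988Convergent, (2.1) p.254, (2.2) p.255] -/
theorem seam_count_le {d : ℕ} (P : Finset (B14DomainGeom.Pt d)) {S Λ Ωk Ωk1 : Set (B14DomainGeom.Pt d)}
    (h21 : Λ ⊆ Ωk) (hdisj : Disjoint S Ωk1) :
    ((P : Set (B14DomainGeom.Pt d)) ∩ (S ∩ Λ)).ncard ≤ ((P : Set (B14DomainGeom.Pt d)) ∩ (Ωk \ Ωk1)).ncard :=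
  Set.ncard_le_ncard (Set.inter_subset_inter_right _ (B14DomainGeom.seam_inter_subset_sdiff h21 hdisj))
    (P.finite_toSet.inter_of_left _)

/-- The same count with the disjointness DISCHARGED by the printed definitions: (3.5) p. 265 for `Ω_{k+1}`, (2.9)
p. 256 `R_k ≤ (L+1)R_{k+1}`, `Λ_k` a union of `MR_k`-cubes (p. 259) — `B14DomainGeom.disjoint_seam_omega35` — and
(2.1) `Λ_k ⊆ Ω_k`: the unit neighbourhood of `Λ_k ∖ Λ_k⁰` counted inside `Λ_k` has at most `|Ω_k ∖ Ω_{k+1}|` points of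
any counting set (M-cube carrier of an 𝐑-produced `Λ_k`: `seam_count_le_omega35_Mcubes`). [cite: Balaban1988Convergent,
(3.5) p.265, (2.9) p.256, (2.1) p.254] -/
theorem seam_count_le_omega35 {d : ℕ} (L M Rk Rk1 ν : ℕ) (hL : 2 ≤ L) (hM : 1 ≤ M) (hRk : 1 ≤ Rk)
    (hR : 1 ≤ Rk1) (hν : 1 ≤ ν) (h29 : (Rk : ℤ) ≤ (L + 1) * Rk1)
    {Λ Pt' Q2 B Ω Ωk : Set (B14DomainGeom.Pt d)} (hΛ : B14DomainGeom.IsUnionOfCubes (M * Rk * ν) Λ)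
    (hB : B = Pt'ᶜ ∩ (B14DomainGeom.enl (L * M * Rk1 * ν) 5 (B14DomainGeom.enl (L * M * Rk1 * ν) 0 Λᶜ))ᶜ)
    (hΩ : Ω = (Q2 ∪ B14DomainGeom.enl (L * M * Rk1 * ν) 3 Bᶜ)ᶜ) (h21 : Λ ⊆ Ωk)
    (P : Finset (B14DomainGeom.Pt d)) :
    ((P : Set (B14DomainGeom.Pt d)) ∩ (B14DomainGeom.seam (M * Rk * ν) 1 (ν : ℤ) Λ ∩ Λ)).ncard ≤
      ((P : Set (B14DomainGeom.Pt d)) ∩ (Ωk \ Ω)).ncard :=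
  seam_count_le P h21 (B14DomainGeom.disjoint_seam_omega35 L M Rk Rk1 ν hL hM hRk hR hν h29 hΛ hB hΩ)

/-- **M-cube carrier (cell GAPS.md G-adv6-13).**  The same count for an 𝐑-produced `Λ_k`, a union of cubes of side
`M·ν` ([Balaban1989LargeFieldI] p. 179), with `Λ_k⁰` = `Λ_k` minus one layer of ITS OWN cubes: instance `R_k := 1` of
`seam_count_le_omega35` — the hypothesis (2.9) becomes `1 ≤ (L+1)R_{k+1}`, automatic. [cite: Balaban1988Convergent,
(3.5) p.265, (2.1) p.254; Balaban1989LargeFieldI, p.179] -/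
theorem seam_count_le_omega35_Mcubes {d : ℕ} (L M Rk1 ν : ℕ) (hL : 2 ≤ L) (hM : 1 ≤ M) (hR : 1 ≤ Rk1)
    (hν : 1 ≤ ν) {Λ Pt' Q2 B Ω Ωk : Set (B14DomainGeom.Pt d)} (hΛ : B14DomainGeom.IsUnionOfCubes (M * ν) Λ)
    (hB : B = Pt'ᶜ ∩ (B14DomainGeom.enl (L * M * Rk1 * ν) 5 (B14DomainGeom.enl (L * M * Rk1 * ν) 0 Λᶜ))ᶜ)
    (hΩ : Ω = (Q2 ∪ B14DomainGeom.enl (L * M * Rk1 * ν) 3 Bᶜ)ᶜ) (h21 : Λ ⊆ Ωk)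
    (P : Finset (B14DomainGeom.Pt d)) :
    ((P : Set (B14DomainGeom.Pt d)) ∩ (B14DomainGeom.seam (M * ν) 1 (ν : ℤ) Λ ∩ Λ)).ncard ≤
      ((P : Set (B14DomainGeom.Pt d)) ∩ (Ωk \ Ω)).ncard := by
  have hΛ' : B14DomainGeom.IsUnionOfCubes (M * 1 * ν) Λ := by simpa using hΛ
  have h29 : ((1 : ℕ) : ℤ) ≤ (L + 1) * Rk1 := by
    have hR' : (1 : ℤ) ≤ Rk1 := by exact_mod_cast hR
    have hL' : (2 : ℤ) ≤ L := by exact_mod_cast hL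
    push_cast; nlinarith
  have h := seam_count_le_omega35 L M 1 Rk1 ν hL hM le_rfl hR hν h29 hΛ' hB hΩ h21 P
  simpa using h

/-! ## C. The per-scale triangle inequality -/

/-- With `T_j` = the bracket of (2.43) for the weight `φ_Ω` (what p. 283 proves) and `e_j` = the j-th summand of
(2.25), `e_j = T_j − β_j·(A(φ_j,U_k) − A(φ_Ω,U_k))`; if the action difference is non-negative,
`|e_j| ≤ |T_j| + |β_j|·(A(φ_j,U_k) − A(φ_Ω,U_k))`. [cite: Balaban1988Convergent, (2.25) p.259, (3.65)-(3.67) p.283] -/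
theorem perScale_seam (T e βj Aφ AΩ : ℝ) (he : e = T - βj * (Aφ - AΩ)) (hA : 0 ≤ Aφ - AΩ) :
    |e| ≤ |T| + |βj| * (Aφ - AΩ) := by
  rw [he]
  have h := abs_add_le T (-(βj * (Aφ - AΩ)))
  rw [abs_neg, abs_mul, abs_of_nonneg hA, ← sub_eq_add_neg] at h
  exact h

/-- Numeric form of the per-scale bound (cell GAPS C-adv6-6 (iii)–(iv), one scale): from `|T_j| ≤ E₁·S_j` ((2.43)
for `φ_Ω`, hypothesis), `|β_j| ≤ β′` (hypothesis; `β′` = the constant of (2.6) p. 255 bounding the β-functions of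
[I] — see the module docstring), `0 ≤ A(φ_j) − A(φ_Ω) ≤ 3c²ε_j²·Γ_j` (§A–§B, hypothesis here; the lower bound is
DISCHARGED from print in §D, `action_diff_nonneg`) and `0 ≤ ε_j ≤ ε_max`: `|e_j| ≤ E₁·S_j + 3c²β′ε_max²·Γ_j`.
[cite: Balaban1988Convergent, (2.43) p.263, (2.6) p.255] -/
theorem perScale_seam_bound (T e βj Aφ AΩ B β' c εj εmax Γj : ℝ) (he : e = T - βj * (Aφ - AΩ))
    (hA0 : 0 ≤ Aφ - AΩ) (hT : |T| ≤ B) (hβ : |βj| ≤ β') (hA : Aφ - AΩ ≤ 3 * c ^ 2 * εj ^ 2 * Γj)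
    (hε0 : 0 ≤ εj) (hε : εj ≤ εmax) (hΓ : 0 ≤ Γj) :
    |e| ≤ B + 3 * c ^ 2 * β' * εmax ^ 2 * Γj := by
  have h0 := perScale_seam T e βj Aφ AΩ he hA0
  have hβ' : 0 ≤ β' := le_trans (abs_nonneg _) hβ
  have h1 : |βj| * (Aφ - AΩ) ≤ β' * (3 * c ^ 2 * εj ^ 2 * Γj) := mul_le_mul hβ hA hA0 hβ'
  have h2 : εj ^ 2 ≤ εmax ^ 2 := pow_le_pow_left₀ hε0 hε 2
  have h3 : 3 * c ^ 2 * εj ^ 2 * Γj ≤ 3 * c ^ 2 * εmax ^ 2 * Γj :=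
    mul_le_mul_of_nonneg_right (mul_le_mul_of_nonneg_left h2 (by positivity)) hΓ
  have h4 : β' * (3 * c ^ 2 * εj ^ 2 * Γj) ≤ β' * (3 * c ^ 2 * εmax ^ 2 * Γj) :=
    mul_le_mul_of_nonneg_left h3 hβ'
  have h5 : β' * (3 * c ^ 2 * εmax ^ 2 * Γj) = 3 * c ^ 2 * β' * εmax ^ 2 * Γj := by ring
  linarith

/-! ## D. Absorbing the seam term into (2.43)'s shape, and the summation over j -/

/-- The `n = j` member of `Σ_{n=j}^{k} (L^{j−n})^β Γ_n` is `Γ_j`, all members are non-negative: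
`Γ_j ≤ Σ_{n=j}^{k} (L^{j−n})^β Γ_n`. [folklore] -/
theorem single_le_geomSum (k j : ℕ) (hj : j ≤ k) (Γ : ℕ → ℝ) (L β : ℝ) (hL : 0 ≤ L)
    (hΓ : ∀ n, j ≤ n → n ≤ k → 0 ≤ Γ n) :
    Γ j ≤ ∑ n ∈ Finset.Icc j k, (L ^ ((j : ℝ) - n)) ^ β * Γ n := by
  have hmem : j ∈ Finset.Icc j k := Finset.mem_Icc.mpr ⟨le_rfl, hj⟩
  have hjj : (L ^ ((j : ℝ) - j)) ^ β * Γ j = Γ j := by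
    rw [sub_self, Real.rpow_zero, Real.one_rpow, one_mul]
  calc Γ j = (L ^ ((j : ℝ) - j)) ^ β * Γ j := hjj.symm
    _ ≤ ∑ n ∈ Finset.Icc j k, (L ^ ((j : ℝ) - n)) ^ β * Γ n := by
        refine Finset.single_le_sum (f := fun n : ℕ => (L ^ ((j : ℝ) - (n : ℝ))) ^ β * Γ n)
          (fun n hn => ?_) hmem
        rw [Finset.mem_Icc] at hn
        exact mul_nonneg (Real.rpow_nonneg (Real.rpow_nonneg hL _) _) (hΓ n hn.1 hn.2)

/-- **Absorption.**  A per-scale bound of the repaired shape `|e_j| ≤ E₁ Σ_{n=j}^{k}(L^{j−n})^β Γ_n + C_s Γ_j`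
(`C_s ≥ 0`) implies the PRINTED per-scale shape of (2.43) with `E₁ + C_s` — so every consumer of (2.43) typed in the
sibling module `B14Thm2` (`bound245_of_243`, `bounds245to249_of_perScale`, `ineq249_of_perScale`) applies verbatim
with the constant `E₁ + C_s`. [cite: Balaban1988Convergent, (2.43) p.263, (2.45) p.263] -/
theorem h243_of_seam (k : ℕ) (e : ℕ → ℝ) (Γ : ℕ → ℝ) (E₁ Cs L β : ℝ) (hL : 0 ≤ L) (hCs : 0 ≤ Cs)
    (hΓ : ∀ n, 1 ≤ n → n ≤ k → 0 ≤ Γ n)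
    (h : ∀ j, 1 ≤ j → j ≤ k →
      |e j| ≤ E₁ * ∑ n ∈ Finset.Icc j k, (L ^ ((j : ℝ) - n)) ^ β * Γ n + Cs * Γ j) :
    ∀ j, 1 ≤ j → j ≤ k → |e j| ≤ (E₁ + Cs) * ∑ n ∈ Finset.Icc j k, (L ^ ((j : ℝ) - n)) ^ β * Γ n := by
  intro j hj1 hjk
  have hs := single_le_geomSum k j hjk Γ L β hL fun n hn1 hn2 => hΓ n (le_trans hj1 hn1) hn2
  have hs' := mul_le_mul_of_nonneg_left hs hCs
  calc |e j| ≤ E₁ * ∑ n ∈ Finset.Icc j k, (L ^ ((j : ℝ) - n)) ^ β * Γ n + Cs * Γ j := h j hj1 hjk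
    _ ≤ E₁ * ∑ n ∈ Finset.Icc j k, (L ^ ((j : ℝ) - n)) ^ β * Γ n +
          Cs * ∑ n ∈ Finset.Icc j k, (L ^ ((j : ℝ) - n)) ^ β * Γ n := by linarith
    _ = (E₁ + Cs) * ∑ n ∈ Finset.Icc j k, (L ^ ((j : ℝ) - n)) ^ β * Γ n := by ring

/-- (2.45) with the absorbed constant, by the sibling module's `B14Thm2.bound245_of_243` applied verbatim:
`|Σ_{j=1}^{k} e_j| ≤ (E₁ + C_s)(1 − L^{−β})^{−1} Σ_{n=1}^{k} Γ_n`. [cite: Balaban1988Convergent, (2.45) p.263] -/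
theorem bound245_seam_absorbed (k : ℕ) (e : ℕ → ℝ) (Γ : ℕ → ℝ) (E₁ Cs L β : ℝ)
    (hL : 1 < L) (hβ : 0 < β) (hE : 0 ≤ E₁) (hCs : 0 ≤ Cs) (hΓ : ∀ n, 1 ≤ n → n ≤ k → 0 ≤ Γ n)
    (h : ∀ j, 1 ≤ j → j ≤ k →
      |e j| ≤ E₁ * ∑ n ∈ Finset.Icc j k, (L ^ ((j : ℝ) - n)) ^ β * Γ n + Cs * Γ j) :
    |∑ j ∈ Finset.Icc 1 k, e j| ≤ (E₁ + Cs) * (1 - L ^ (-β))⁻¹ * ∑ n ∈ Finset.Icc 1 k, Γ n := by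
  have h243 := h243_of_seam k e Γ E₁ Cs L β (by linarith) hCs hΓ h
  obtain ⟨h1, h2⟩ := B14Thm2.bound245_of_243 k e Γ (E₁ + Cs) L β hL hβ (add_nonneg hE hCs) hΓ h243
  exact le_trans h1 h2

/-- **(2.45) with the seam term, sharp constant** (cell GAPS C-adv6-6 (iv)): a per-scale bound
`|e_j| ≤ E₁ Σ_{n=j}^{k}(L^{j−n})^β Γ_n + C_s Γ_j`, `j = 1, …, k`, gives
`|Σ_{j=1}^{k} e_j| ≤ (E₁(1 − L^{−β})^{−1} + C_s) Σ_{n=1}^{k} Γ_n`.  Content: `|Σ e_j| ≤ Σ |e_j|`, the printed double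
summation of (2.45) for the first part (the sibling module's `B14Thm2.bound245_of_243`, applied to the non-negative
majorants), and `Σ_j C_s Γ_j = C_s Σ_n Γ_n` for the second. [cite: Balaban1988Convergent, (2.45) p.263] -/
theorem bound245_seam (k : ℕ) (e : ℕ → ℝ) (Γ : ℕ → ℝ) (E₁ Cs L β : ℝ)
    (hL : 1 < L) (hβ : 0 < β) (hE : 0 ≤ E₁) (hΓ : ∀ n, 1 ≤ n → n ≤ k → 0 ≤ Γ n)
    (h : ∀ j, 1 ≤ j → j ≤ k →
      |e j| ≤ E₁ * ∑ n ∈ Finset.Icc j k, (L ^ ((j : ℝ) - n)) ^ β * Γ n + Cs * Γ j) :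
    |∑ j ∈ Finset.Icc 1 k, e j| ≤ (E₁ * (1 - L ^ (-β))⁻¹ + Cs) * ∑ n ∈ Finset.Icc 1 k, Γ n := by
  have hS0 : ∀ j, 1 ≤ j → j ≤ k → 0 ≤ ∑ n ∈ Finset.Icc j k, (L ^ ((j : ℝ) - n)) ^ β * Γ n := by
    intro j hj1 _
    refine Finset.sum_nonneg fun n hn => ?_
    rw [Finset.mem_Icc] at hn
    exact mul_nonneg (Real.rpow_nonneg (Real.rpow_nonneg (by linarith) _) _) (hΓ n (le_trans hj1 hn.1) hn.2)
  have h243' : ∀ j, 1 ≤ j → j ≤ k →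
      |E₁ * ∑ n ∈ Finset.Icc j k, (L ^ ((j : ℝ) - n)) ^ β * Γ n| ≤
        E₁ * ∑ n ∈ Finset.Icc j k, (L ^ ((j : ℝ) - n)) ^ β * Γ n := by
    intro j hj1 hjk
    rw [abs_of_nonneg (mul_nonneg hE (hS0 j hj1 hjk))]
  obtain ⟨h1, h2⟩ := B14Thm2.bound245_of_243 k
    (fun j => E₁ * ∑ n ∈ Finset.Icc j k, (L ^ ((j : ℝ) - n)) ^ β * Γ n) Γ E₁ L β hL hβ hE hΓ h243'
  have hmain : ∑ j ∈ Finset.Icc 1 k, E₁ * ∑ n ∈ Finset.Icc j k, (L ^ ((j : ℝ) - n)) ^ β * Γ n ≤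
      E₁ * (1 - L ^ (-β))⁻¹ * ∑ n ∈ Finset.Icc 1 k, Γ n :=
    le_trans (le_abs_self _) (le_trans h1 h2)
  calc |∑ j ∈ Finset.Icc 1 k, e j| ≤ ∑ j ∈ Finset.Icc 1 k, |e j| := Finset.abs_sum_le_sum_abs _ _
    _ ≤ ∑ j ∈ Finset.Icc 1 k, (E₁ * ∑ n ∈ Finset.Icc j k, (L ^ ((j : ℝ) - n)) ^ β * Γ n + Cs * Γ j) := by
        refine Finset.sum_le_sum fun j hj => ?_
        rw [Finset.mem_Icc] at hj
        exact h j hj.1 hj.2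
    _ = ∑ j ∈ Finset.Icc 1 k, E₁ * ∑ n ∈ Finset.Icc j k, (L ^ ((j : ℝ) - n)) ^ β * Γ n +
          Cs * ∑ j ∈ Finset.Icc 1 k, Γ j := by
        rw [Finset.sum_add_distrib, Finset.mul_sum]
    _ ≤ E₁ * (1 - L ^ (-β))⁻¹ * ∑ n ∈ Finset.Icc 1 k, Γ n + Cs * ∑ j ∈ Finset.Icc 1 k, Γ j := by
        linarith
    _ = (E₁ * (1 - L ^ (-β))⁻¹ + Cs) * ∑ n ∈ Finset.Icc 1 k, Γ n := by ring

/-- The two ways of writing the repaired constant agree: *"the PRINTED SHAPE of (2.45) with E₁ replaced by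
E₁ + C_s(1 − L^{−β})"* (cell GAPS C-adv6-6 (iv)) is `(E₁ + C_s(1 − L^{−β}))(1 − L^{−β})^{−1} = E₁(1 − L^{−β})^{−1} +
C_s`. [folklore] -/
theorem constant_shape (E₁ Cs q : ℝ) (hq : q ≠ 0) : (E₁ + Cs * q) * q⁻¹ = E₁ * q⁻¹ + Cs := by
  field_simp

/-- **(2.45) repaired, assembled from the per-scale data** (cell GAPS C-adv6-6 (i)–(iv) as one kernel statement).
For `j = 1, …, k` let `T j` be the bracket of (2.43) for the weight `φ_Ω` (bounded as printed: hypothesis `hT`),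
`e j = T j − β j · D j` the j-th summand of (2.25) with `D j = A(φ_j, U_k) − A(φ_Ω, U_k)` the seam term
(`0 ≤ D j ≤ 3c²(ε j)²·Γ j`: §A–§B, hypothesis `hD`), `|β j| ≤ β′`, `0 ≤ ε j ≤ ε_max`.  Then
`|Σ_{j=1}^{k} e j| ≤ (E₁(1 − L^{−β})^{−1} + 3c²β′ε_max²) Σ_{n=1}^{k} Γ n`.
[cite: Balaban1988Convergent, (2.25) p.259, (2.43) p.263, (2.45) p.263, (3.65) p.283] -/
theorem ineq245_seam (k : ℕ) (T e β D ε Γ : ℕ → ℝ) (E₁ L βexp β' c εmax : ℝ)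
    (hL : 1 < L) (hβexp : 0 < βexp) (hE : 0 ≤ E₁) (hΓ : ∀ n, 1 ≤ n → n ≤ k → 0 ≤ Γ n)
    (he : ∀ j, 1 ≤ j → j ≤ k → e j = T j - β j * D j)
    (hT : ∀ j, 1 ≤ j → j ≤ k → |T j| ≤ E₁ * ∑ n ∈ Finset.Icc j k, (L ^ ((j : ℝ) - n)) ^ βexp * Γ n)
    (hβ' : ∀ j, 1 ≤ j → j ≤ k → |β j| ≤ β')
    (hD0 : ∀ j, 1 ≤ j → j ≤ k → 0 ≤ D j) (hD : ∀ j, 1 ≤ j → j ≤ k → D j ≤ 3 * c ^ 2 * (ε j) ^ 2 * Γ j)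
    (hε0 : ∀ j, 1 ≤ j → j ≤ k → 0 ≤ ε j) (hε : ∀ j, 1 ≤ j → j ≤ k → ε j ≤ εmax) :
    |∑ j ∈ Finset.Icc 1 k, e j| ≤
      (E₁ * (1 - L ^ (-βexp))⁻¹ + 3 * c ^ 2 * β' * εmax ^ 2) * ∑ n ∈ Finset.Icc 1 k, Γ n := by
  refine bound245_seam k e Γ E₁ (3 * c ^ 2 * β' * εmax ^ 2) L βexp hL hβexp hE hΓ fun j hj1 hjk => ?_
  have hAd : 0 ≤ D j - 0 := by simpa using hD0 j hj1 hjk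
  have hAu : D j - 0 ≤ 3 * c ^ 2 * (ε j) ^ 2 * Γ j := by simpa using hD j hj1 hjk
  have := perScale_seam_bound (T j) (e j) (β j) (D j) 0
    (E₁ * ∑ n ∈ Finset.Icc j k, (L ^ ((j : ℝ) - n)) ^ βexp * Γ n) β' c (ε j) εmax (Γ j)
    (by rw [he j hj1 hjk, sub_zero]) hAd (hT j hj1 hjk) (hβ' j hj1 hjk) hAu
    (hε0 j hj1 hjk) (hε j hj1 hjk) (hΓ j hj1 hjk)
  linarith

/-! ## D. (v2) The sign `0 ≤ A(φ_j − φ_Ω, U)` discharged from (3.40), p. 283 and (2.24)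

Cell journal NOTE pv21 → pv02 (2026-08-18T17:43Z): the hypothesis `hD0`/`hA0` (`0 ≤ A(φ_j, U) − A(φ_Ω, U)`) follows
from three printed facts — (3.40) p. 275 [PDF 33]: *"h_z(x) = Π_{μ=1}^{d} h(x_μ − z_μ), h(t) = max{1 − L⁻¹|t|, 0}.
(3.40) They form a decomposition of unity: Σ_z h_z = 1."*; p. 283 [PDF 41]: *"where h_z is defined as in (3.40), but
on the lattice T_{L^{−j}}, and with h(t) = max{1 − |t|, 0}. For z ∈ Λ_j⁰ we have h_zφ_j = h_z"*; and `0 ≤ φ_j`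
((2.24)–(2.25) p. 259: `φ_j ∈ C₀^∞(Λ_j)`, a cut-off function — its range `[0, 1]` is this reader's standing reading,
kept as the hypothesis `hφ0`).  With `φ_Ω = Σ_{z ∈ Ω} h_z` for a finite `Ω ⊂ Λ_j⁰` (the localizations summed in
(2.45), cell GAPS C-adv6-6): pointwise `Σ_{z∈Ω} h_z = φ_j · Σ_{z∈Ω} h_z ≤ φ_j`.
v4/v4.1 PRECISION (cell GAPS.md G-adv6-20, G-pv13g3-2): of the three, *"For z ∈ Λ_j⁰ we have h_zφ_j = h_z"* is a
printed SENTENCE whose derivation from the printed DEFINITIONS depends on the cube family of `∼` in (2.24), which p. 259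
does not name: (2.24) gives `φ_j = 1` on `Λ_j^{∼−1}`; if `∼` removes a layer of `MR_j`-cubes (the reading of cell row
G-adv6-20; p. 256 [PDF 14] *"The domains Ω_j, Λ_j … are unions of MR_j-cubes"*), then `Λ_j^{∼−1} = Λ_j⁰` and the unit
tent of a centre `z ∈ Λ_j⁰` adjacent to `∂Λ_j⁰` weighs points outside it, so the sentence is an extra condition; if `∼`
is [Balaban1987RG1] p. 257's operation over the `M`-cubes `π_j` (p. 263's *"the operation ∼ is in the corresponding
scale"* fixing the lattice, B14 naming deviations explicitly as on p. 256 *"where the operation ∼ is taken for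
M₁-cubes"*), then `Λ_j^{∼−1} ⊋ Λ_j⁰` and the sentence FOLLOWS for `g_j` small (`2M + 1 ≤ MR_j`, i.e. `R_j ≥ 3`, from
(2.5) p. 255).  It stays the HYPOTHESIS `hΛ0` below (obtainable from `tent_mul_eq_of_eq_one_on_support` in §E with
`U = Λ_j^{∼−1}` resp. adv6's unit neighbourhood of `Λ_j⁰`); §E shows the seam bound and its constant do not need it. -/

/-- From the decomposition of unity `Σ_{z ∈ T} h_z = 1` ((3.40) p. 275) and `h_z ≥ 0` (the tent (3.40) is a `max{…, 0}`):
every partial sum over `Ω ⊆ T` is `≤ 1`. [cite: Balaban1988Convergent, (3.40) p.275] -/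
theorem partial_unity_le_one {Z : Type*} (T Ω : Finset Z) (hΩ : Ω ⊆ T) (h : Z → X → ℝ)
    (hh0 : ∀ z y, 0 ≤ h z y) (hunity : ∀ y, ∑ z ∈ T, h z y = 1) (y : X) : ∑ z ∈ Ω, h z y ≤ 1 := by
  rw [← hunity y]
  exact Finset.sum_le_sum_of_subset_of_nonneg hΩ fun z _ _ => hh0 z y

/-- p. 283: *"For z ∈ Λ_j⁰ we have h_zφ_j = h_z"* (hypothesis `hΛ0`, for the `z ∈ Ω ⊂ Λ_j⁰`), `h_z ≥ 0`, a partial sum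
`Σ_{z∈Ω} h_z ≤ 1` and `φ_j ≥ 0` give, pointwise, `0 ≤ φ_j − φ_Ω` with `φ_Ω = Σ_{z∈Ω} h_z`.  (v4/v4.1, cell GAPS.md G-adv6-20,
G-pv13g3-2: `hΛ0` is the printed sentence itself; under the `MR_j`-cube reading of `∼` in (2.24) it is NOT implied by
(2.24) "φ_j = 1 on Λ_j^{∼−1}" + p. 259 (`Λ_j^{∼−1} = Λ_j⁰` and unit tents of boundary-adjacent centres leave `Λ_j⁰`),
under [Balaban1987RG1] p. 257's `M`-cube reading it follows for `g_j` small (`R_j ≥ 3` by (2.5)) via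
`tent_mul_eq_of_eq_one_on_support` with `U = Λ_j^{∼−1}`; §E does without it either way.)
[cite: Balaban1988Convergent, p.283, (3.40) p.275, (2.24) p.259] -/
theorem weight_diff_nonneg {Z : Type*} (Ω : Finset Z) (h : Z → X → ℝ) (φ : X → ℝ)
    (hsum : ∀ y, ∑ z ∈ Ω, h z y ≤ 1) (hφ0 : ∀ y, 0 ≤ φ y)
    (hΛ0 : ∀ z ∈ Ω, ∀ y, h z y * φ y = h z y) (y : X) :
    0 ≤ φ y - ∑ z ∈ Ω, h z y := by
  have hrew : ∑ z ∈ Ω, h z y = φ y * ∑ z ∈ Ω, h z y := by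
    rw [Finset.mul_sum]
    refine Finset.sum_congr rfl fun z hz => ?_
    rw [mul_comm, hΛ0 z hz y]
  have hle : φ y * ∑ z ∈ Ω, h z y ≤ φ y * 1 := mul_le_mul_of_nonneg_left (hsum y) (hφ0 y)
  rw [mul_one] at hle
  linarith

/-- The sign hypothesis of §C reduced to `hΛ0` (p. 283's printed sentence, see `weight_diff_nonneg`; v4: a hypothesis,
not a consequence of the printed definitions — cell GAPS.md G-adv6-20): with plaquette terms `0 ≤ w p` (B11 (5):
`1 − Re tr U(∂p) ≥ 0`, hypothesis `hw0`), `A(φ_j, U) − A(φ_Ω, U) = A(φ_j − φ_Ω, U) ≥ 0`. Feeds `hA0` of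
`perScale_seam_bound` / `hD0` of `ineq245_seam`; the sign-free route is §E.
[cite: Balaban1988Convergent, p.253, p.283, (3.40) p.275; Balaban1985Variational, (5) p.278] -/
theorem action_diff_nonneg {Z : Type*} (plaq : Finset P) (x : P → X) (w : P → ℝ)
    (hw0 : ∀ p ∈ plaq, 0 ≤ w p) (Ω : Finset Z) (h : Z → X → ℝ) (φ : X → ℝ)
    (hsum : ∀ y, ∑ z ∈ Ω, h z y ≤ 1) (hφ0 : ∀ y, 0 ≤ φ y) (hΛ0 : ∀ z ∈ Ω, ∀ y, h z y * φ y = h z y) :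
    0 ≤ weightedAction plaq x w φ - weightedAction plaq x w (fun y => ∑ z ∈ Ω, h z y) := by
  rw [weightedAction_sub]
  exact weightedAction_nonneg plaq x w _ (fun y => weight_diff_nonneg Ω h φ hsum hφ0 hΛ0 y) hw0

/-! ## E. (v4) The seam term WITHOUT p. 283's "h_zφ_j = h_z": sign-free estimate, same constant (cell GAPS.md G-adv6-20)

Cell GAPS.md G-adv6-20 (adversarial reader adv6, gen 8; renders p017, p021, p041 re-read by this unit) and, for the
reading clauses, G-pv13g3-2 (cross-reader pv13 gen 3; renders p013, p014 and 1987-cmp109 p009 re-read, v4.1).  The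
sentence p. 283 [PDF 41] *"For z ∈ Λ_j⁰ we have h_zφ_j = h_z"* is PRINTED; whether it follows from (2.24) p. 259
[PDF 17] *"φ_j ∈ C₀^∞(Λ_j), φ_j = 1 on Λ_j^{∼−1}"* and p. 259 *"Λ_j⁰ the set which is obtained by removing one layer of
the MR_j-cubes from Λ_j^{(j)}"* depends on the cube family of `∼` in (2.24), which p. 259 does not name (p. 263 [PDF 21]
*"the operation ∼ is in the corresponding scale"* fixes the lattice).  Under the `MR_j`-cube reading (cell row
G-adv6-20's; p. 256 [PDF 14] *"The domains Ω_j, Λ_j, which are determined by he* [sic] *j-th renormalization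
transformation, but not by the 𝐑-operation, are unions of MR_j-cubes in the lattice T_{L^{−j}}"*) one has `Λ_j^{∼−1} =
Λ_j⁰` (`innerN s 1 Λ` for both), and the unit tent `h_z` (*"h(t) = max{1 − |t|, 0}"* on `T_{L^{−j}}`) of a centre
`z ∈ Λ_j⁰` next to `∂Λ_j⁰` weighs fine points outside `Λ_j⁰`, where `φ_j` is then free: the sentence is an extra
condition.  Under [Balaban1987RG1] p. 257 [PDF 9]'s reading (*"We decompose the space T into the lattice of closed cubes
of a size M … We denote this family of cubes by π_j … For a cube □ ∈ π_j and n = 1, 2, … we define □̃ⁿ as a cube of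
the size (1+2n)M and with a center at the center of □. … The meaning of the symbol X̃ⁿ should be obvious."*; B14 names
its deviations explicitly, p. 256 *"where the operation ∼ is taken for M₁-cubes"*) `Λ_j^{∼−1} ⊋ Λ_j⁰`, and the sentence
FOLLOWS from (2.24): a point weighed by `h_z` is within `1` of `z`, a point of an `M`-cube adjacent to its cube within
`2M + 1` of `z`, and `z ∈ Λ_j⁰` keeps the sup-`MR_j` neighbourhood of `z` in `Λ_j` (`B14DomainGeom.within_innerN_subset`),
so `supp h_z ⊆ Λ_j^{∼−1}` once `2M + 1 ≤ MR_j`, i.e. `R_j ≥ 3` — given for `g_j` small by (2.5) p. 255 [PDF 13] *"R_j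
is the smallest number of the form L^r such, that R_j ≥ (log g_j⁻²)^r."* (so v4's *"`R_j ≥ 2`, equally unprinted"* was
not right: the size of `R_j` IS printed).  In §§C–D above that sentence is the HYPOTHESIS `hΛ0` of `weight_diff_nonneg`
/ `action_diff_nonneg`, and it is used for ONE purpose only: the sign `0 ≤ A(φ_j − φ_Ω, U)` (`hA0` of
`perScale_seam_bound`, `hD0` of `ineq245_seam`).  This section shows the sign is dispensable and the constant unchanged
under EITHER reading: from (2.24)'s `φ_j = 1` on `Λ_j^{∼−1} ⊇ Λ_j⁰`, the decomposition of unity `Σ_z h_z = 1` ((3.40)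
p. 275), the unit support
of the tents, `h_z ≥ 0` and `0 ≤ φ_j ≤ 1` alone, `ψ := φ_j − φ_Ω` (`φ_Ω = Σ_{z∈Λ_j⁰} h_z`) VANISHES off the seam
(`diff_eq_zero_off_seam`: off the seam every non-zero tent has its centre in `Λ_j⁰`, so `φ_Ω = Σ_{all z} h_z = 1 = φ_j`)
and `|ψ| ≤ 1` everywhere (`abs_diff_le_one`); hence `|A(ψ, U)| ≤ A(|ψ|, U) ≤ b·m·|S|` (`weightedAction_abs_seam_le`, the
§A estimate applied to `|ψ|`), the sign-free per-scale triangle inequality `|e_j| ≤ |T_j| + |β_j|·|D_j|` (`perScale_abs`,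
`perScale_abs_bound`), and (2.45) with the SAME constant `E₁(1 − L^{−β})^{−1} + 3c²β′ε_max²` (`ineq245_seam_abs` =
`ineq245_seam` with `0 ≤ D_j ≤ 3c²ε_j²Γ_j` replaced by `|D_j| ≤ 3c²ε_j²Γ_j`; `ineq245_seam` is its corollary
`ineq245_seam_of_sign`).  G-adv6-20's repair (a) (*demand* `φ_j = 1` on the unit neighbourhood of `Λ_j⁰`) is the one-line
`tent_mul_eq_of_eq_one_on_support` (it yields `hΛ0`; the room for the demand is `B14DomainGeom.nbhd_of_nbhd_innerN_subset`);
its repair (b) ("the offending z lie in Γ_j") is subsumed — the whole seam, offending tents included, is what §B counts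
(`|S ∩ Λ_j| ≤ |Γ_j|`, `seam_count_le_omega35`).  The two set-membership facts of the `ℤ^d` model are consumed from the
sibling module `B14DomainGeom` (v3 §E) in `tent_support_seam` / `eq_one_off_seam`.  Consequence for the cell: NONE for the
constant of row C-adv6-6 (iv); `hΛ0` is reclassified from "discharged from print" (v2 §D) to "printed sentence whose
derivation from the printed definitions depends on the unprinted cube family of `∼` in (2.24) (extra condition under the
`MR_j`-cube reading, consequence for `g_j` small under the `M`-cube reading; G-pv13g3-2), and not needed".  Revision
v4.1: the reading clauses of this header and of four docstrings (§D note, `weight_diff_nonneg`,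
`tent_mul_eq_of_eq_one_on_support`, `diff_eq_zero_off_seam`, `eq_one_off_seam`); no declaration touched.
-/

/-- **G-adv6-20 repair (a), one line.**  If every tent `h_z`, `z ∈ Ω`, is supported in a set `U` on which `φ = 1`, then
`h_zφ = h_z` for `z ∈ Ω` — the hypothesis `hΛ0` of `weight_diff_nonneg`.  (B14 prints `φ_j = 1` on `Λ_j^{∼−1}`, (2.24);
with `U` = the unit neighbourhood of `Λ_j⁰` the hypothesis is adv6's repair (a) — a strengthening of (2.24) under the
`MR_j`-cube reading of `∼`, a consequence of (2.24) with `U = Λ_j^{∼−1}` under [Balaban1987RG1] p. 257's `M`-cube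
reading once `2M + 1 ≤ MR_j` (cell GAPS.md G-pv13g3-2; §E header).)
[cite: Balaban1988Convergent, p.283 ("For z ∈ Λ_j^0 we have h_zφ_j = h_z"), (2.24) p.259] -/
theorem tent_mul_eq_of_eq_one_on_support {Z : Type*} (Ω : Finset Z) (h : Z → X → ℝ) (φ : X → ℝ) (U : Set X)
    (hsupp : ∀ z ∈ Ω, ∀ y, h z y ≠ 0 → y ∈ U) (hU : ∀ y ∈ U, φ y = 1) :
    ∀ z ∈ Ω, ∀ y, h z y * φ y = h z y := by
  intro z hz y
  by_cases hy : h z y = 0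
  · rw [hy, zero_mul]
  · rw [hU y (hsupp z hz y hy), mul_one]

/-- **Support of `φ − φ_Ω` without p. 283's sentence.**  Tents `h_z`, `z ∈ T` (all centres; `T` finite — the torus
`T^{(j)}`), forming a decomposition of unity at the point `y` ((3.40): *"Σ_z h_z = 1"*); `Ω ⊆ T` the centres kept in
`φ_Ω = Σ_{z∈Ω} h_z`; every tent with centre in `T ∖ Ω` supported in `S` (the seam); and `φ = 1` off `S` ((2.24): off the
seam one is in `Λ_j⁰ ⊆ Λ_j^{∼−1}`).  Then `φ − φ_Ω = 0` off `S`. [cite: Balaban1988Convergent, (3.40) p.275, (2.24)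
p.259, (3.65) p.283] -/
theorem diff_eq_zero_off_seam {Z : Type*} (T Ω : Finset Z) (hΩ : Ω ⊆ T) (h : Z → X → ℝ) (φ : X → ℝ) (S : Set X)
    (hout : ∀ z ∈ T, z ∉ Ω → ∀ y, h z y ≠ 0 → y ∈ S) (hφS : ∀ y, y ∉ S → φ y = 1)
    (y : X) (hy : y ∉ S) (hunity : ∑ z ∈ T, h z y = 1) : φ y - ∑ z ∈ Ω, h z y = 0 := by
  have hvan : ∀ z ∈ T, z ∉ Ω → h z y = 0 := fun z hz hzΩ => by
    by_contra hne
    exact hy (hout z hz hzΩ y hne)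
  rw [Finset.sum_subset hΩ hvan, hunity, hφS y hy, sub_self]

/-- `|φ − φ_Ω| ≤ 1` pointwise, from `0 ≤ φ ≤ 1` (cut-off) and `0 ≤ Σ_{z∈Ω} h_z ≤ 1` (`h_z ≥ 0`, `partial_unity_le_one`).
[cite: Balaban1988Convergent, (3.40) p.275, (2.24) p.259] -/
theorem abs_diff_le_one {Z : Type*} (Ω : Finset Z) (h : Z → X → ℝ) (φ : X → ℝ)
    (hh0 : ∀ z y, 0 ≤ h z y) (hsum : ∀ y, ∑ z ∈ Ω, h z y ≤ 1)
    (hφ0 : ∀ y, 0 ≤ φ y) (hφ1 : ∀ y, φ y ≤ 1) (y : X) : |φ y - ∑ z ∈ Ω, h z y| ≤ 1 := by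
  have h0 : 0 ≤ ∑ z ∈ Ω, h z y := Finset.sum_nonneg fun z _ => hh0 z y
  rw [abs_le]
  constructor <;> linarith [hsum y, hφ0 y, hφ1 y]

/-- **Sign-free seam estimate.**  A weight with `|ψ| ≤ 1`, vanishing off the finite point set `S`, plaquette terms
`0 ≤ w p` everywhere and `w p ≤ b` whenever `x p ∈ S`, at most `m` plaquettes per initial point in `S`:
`|A(ψ, U)| ≤ b·m·|S|` — `|A(ψ,U)| ≤ A(|ψ|,U)` and §A's `weightedAction_seam_le` for `|ψ|`. [cite: Balaban1988Convergent,
p.253, (3.65) p.283; Balaban1985Variational, (2) p.278, (5) p.278] -/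
theorem weightedAction_abs_seam_le [DecidableEq X] (plaq : Finset P) (x : P → X) (w : P → ℝ) (ψ : X → ℝ)
    (S : Finset X) (b : ℝ) (m : ℕ) (hb : 0 ≤ b)
    (hψ1 : ∀ y, |ψ y| ≤ 1) (hψS : ∀ y, y ∉ S → ψ y = 0)
    (hw0 : ∀ p ∈ plaq, 0 ≤ w p) (hwb : ∀ p ∈ plaq, x p ∈ S → w p ≤ b)
    (hm : ∀ y ∈ S, ((plaq.filter fun p => x p = y).card : ℝ) ≤ m) :
    |weightedAction plaq x w ψ| ≤ b * m * S.card := by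
  have habs : |weightedAction plaq x w ψ| ≤ weightedAction plaq x w (fun y => |ψ y|) := by
    unfold weightedAction
    show |∑ p ∈ plaq, ψ (x p) * w p| ≤ ∑ p ∈ plaq, |ψ (x p)| * w p
    refine (Finset.abs_sum_le_sum_abs _ _).trans (le_of_eq (Finset.sum_congr rfl fun p hp => ?_))
    rw [abs_mul, abs_of_nonneg (hw0 p hp)]
  refine habs.trans (weightedAction_seam_le plaq x w (fun y => |ψ y|) S b m hb hψ1 ?_ hw0 hwb hm)
  intro y hy
  show |ψ y| = 0
  rw [hψS y hy, abs_zero]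

/-- Sign-free per-scale triangle inequality: `e_j = T_j − β_j·D_j` ⟹ `|e_j| ≤ |T_j| + |β_j|·|D_j|`. [folklore] -/
theorem perScale_abs (T e βj D : ℝ) (he : e = T - βj * D) : |e| ≤ |T| + |βj| * |D| := by
  rw [he]
  have h := abs_add_le T (-(βj * D))
  rw [abs_neg, abs_mul, ← sub_eq_add_neg] at h
  exact h

/-- Numeric per-scale bound, sign-free (cf. `perScale_seam_bound`): `|T_j| ≤ B`, `|β_j| ≤ β′`, `|D_j| ≤ 3c²ε_j²Γ_j`,
`0 ≤ ε_j ≤ ε_max`, `0 ≤ Γ_j` ⟹ `|e_j| ≤ B + 3c²β′ε_max²Γ_j`. [cite: Balaban1988Convergent, (2.43) p.263, (2.6) p.255] -/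
theorem perScale_abs_bound (T e βj D B β' c εj εmax Γj : ℝ) (he : e = T - βj * D)
    (hT : |T| ≤ B) (hβ : |βj| ≤ β') (hD : |D| ≤ 3 * c ^ 2 * εj ^ 2 * Γj)
    (hε0 : 0 ≤ εj) (hε : εj ≤ εmax) (hΓ : 0 ≤ Γj) :
    |e| ≤ B + 3 * c ^ 2 * β' * εmax ^ 2 * Γj := by
  have h0 := perScale_abs T e βj D he
  have hβ' : 0 ≤ β' := le_trans (abs_nonneg _) hβ
  have h1 : |βj| * |D| ≤ β' * (3 * c ^ 2 * εj ^ 2 * Γj) := mul_le_mul hβ hD (abs_nonneg _) hβ'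
  have h2 : εj ^ 2 ≤ εmax ^ 2 := pow_le_pow_left₀ hε0 hε 2
  have h3 : 3 * c ^ 2 * εj ^ 2 * Γj ≤ 3 * c ^ 2 * εmax ^ 2 * Γj :=
    mul_le_mul_of_nonneg_right (mul_le_mul_of_nonneg_left h2 (by positivity)) hΓ
  have h4 : β' * (3 * c ^ 2 * εj ^ 2 * Γj) ≤ β' * (3 * c ^ 2 * εmax ^ 2 * Γj) :=
    mul_le_mul_of_nonneg_left h3 hβ'
  have h5 : β' * (3 * c ^ 2 * εmax ^ 2 * Γj) = 3 * c ^ 2 * β' * εmax ^ 2 * Γj := by ring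
  linarith

/-- **(2.45) repaired, sign-free** (cell GAPS G-adv6-20 × C-adv6-6 (iv)).  As `ineq245_seam`, but the seam term `D j =
A(φ_j, U_k) − A(φ_Ω, U_k)` is only assumed SMALL IN ABSOLUTE VALUE, `|D j| ≤ 3c²(ε j)²·Γ j` (§A `weightedAction_abs_seam_le`
+ §B), with no sign and no use of p. 283's *"h_zφ_j = h_z"*:
`|Σ_{j=1}^{k} e j| ≤ (E₁(1 − L^{−β})^{−1} + 3c²β′ε_max²) Σ_{n=1}^{k} Γ n` — the same constant.
[cite: Balaban1988Convergent, (2.25) p.259, (2.43) p.263, (2.45) p.263, (3.65) p.283] -/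
theorem ineq245_seam_abs (k : ℕ) (T e β D ε Γ : ℕ → ℝ) (E₁ L βexp β' c εmax : ℝ)
    (hL : 1 < L) (hβexp : 0 < βexp) (hE : 0 ≤ E₁) (hΓ : ∀ n, 1 ≤ n → n ≤ k → 0 ≤ Γ n)
    (he : ∀ j, 1 ≤ j → j ≤ k → e j = T j - β j * D j)
    (hT : ∀ j, 1 ≤ j → j ≤ k → |T j| ≤ E₁ * ∑ n ∈ Finset.Icc j k, (L ^ ((j : ℝ) - n)) ^ βexp * Γ n)
    (hβ' : ∀ j, 1 ≤ j → j ≤ k → |β j| ≤ β')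
    (hDabs : ∀ j, 1 ≤ j → j ≤ k → |D j| ≤ 3 * c ^ 2 * (ε j) ^ 2 * Γ j)
    (hε0 : ∀ j, 1 ≤ j → j ≤ k → 0 ≤ ε j) (hε : ∀ j, 1 ≤ j → j ≤ k → ε j ≤ εmax) :
    |∑ j ∈ Finset.Icc 1 k, e j| ≤
      (E₁ * (1 - L ^ (-βexp))⁻¹ + 3 * c ^ 2 * β' * εmax ^ 2) * ∑ n ∈ Finset.Icc 1 k, Γ n := by
  refine bound245_seam k e Γ E₁ (3 * c ^ 2 * β' * εmax ^ 2) L βexp hL hβexp hE hΓ fun j hj1 hjk => ?_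
  have := perScale_abs_bound (T j) (e j) (β j) (D j)
    (E₁ * ∑ n ∈ Finset.Icc j k, (L ^ ((j : ℝ) - n)) ^ βexp * Γ n) β' c (ε j) εmax (Γ j)
    (he j hj1 hjk) (hT j hj1 hjk) (hβ' j hj1 hjk) (hDabs j hj1 hjk) (hε0 j hj1 hjk) (hε j hj1 hjk) (hΓ j hj1 hjk)
  linarith

/-- `ineq245_seam` (§D, with the sign) is the corollary of `ineq245_seam_abs`: `0 ≤ D j ≤ X` gives `|D j| ≤ X`.
[folklore] -/
theorem ineq245_seam_of_sign (k : ℕ) (T e β D ε Γ : ℕ → ℝ) (E₁ L βexp β' c εmax : ℝ)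
    (hL : 1 < L) (hβexp : 0 < βexp) (hE : 0 ≤ E₁) (hΓ : ∀ n, 1 ≤ n → n ≤ k → 0 ≤ Γ n)
    (he : ∀ j, 1 ≤ j → j ≤ k → e j = T j - β j * D j)
    (hT : ∀ j, 1 ≤ j → j ≤ k → |T j| ≤ E₁ * ∑ n ∈ Finset.Icc j k, (L ^ ((j : ℝ) - n)) ^ βexp * Γ n)
    (hβ' : ∀ j, 1 ≤ j → j ≤ k → |β j| ≤ β')
    (hD0 : ∀ j, 1 ≤ j → j ≤ k → 0 ≤ D j) (hD : ∀ j, 1 ≤ j → j ≤ k → D j ≤ 3 * c ^ 2 * (ε j) ^ 2 * Γ j)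
    (hε0 : ∀ j, 1 ≤ j → j ≤ k → 0 ≤ ε j) (hε : ∀ j, 1 ≤ j → j ≤ k → ε j ≤ εmax) :
    |∑ j ∈ Finset.Icc 1 k, e j| ≤
      (E₁ * (1 - L ^ (-βexp))⁻¹ + 3 * c ^ 2 * β' * εmax ^ 2) * ∑ n ∈ Finset.Icc 1 k, Γ n :=
  ineq245_seam_abs k T e β D ε Γ E₁ L βexp β' c εmax hL hβexp hE hΓ he hT hβ'
    (fun j hj1 hjk => by rw [abs_of_nonneg (hD0 j hj1 hjk)]; exact hD j hj1 hjk) hε0 hε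

/-- **The `ℤ^d` model's membership facts, consumed** (sibling module `B14DomainGeom` v3 §E).  Tents of sup-radius `ν`
(`h z y ≠ 0 → Within ν y z`, (3.65): unit tents on `T_{L^{−j}}`), `Λ_j⁰ = innerN s 1 Λ_j` (side `s` of `Λ_j`'s own cubes),
kept centres `Ω ⊇ T ∩ Λ_j⁰`: every tent with centre in `T ∖ Ω` is supported in `seam s 1 ν Λ_j` — the hypothesis `hout`
of `diff_eq_zero_off_seam`. [cite: Balaban1988Convergent, (3.65) p.283, p.259 (Λ_j^0)] -/
theorem tent_support_seam {d : ℕ} (s : ℕ) (ν : ℤ) (Λ : Set (B14DomainGeom.Pt d))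
    (T Ω : Finset (B14DomainGeom.Pt d)) (hΩ : ∀ z ∈ T, z ∈ B14DomainGeom.innerN s 1 Λ → z ∈ Ω)
    (h : B14DomainGeom.Pt d → B14DomainGeom.Pt d → ℝ) (hsupp : ∀ z y, h z y ≠ 0 → B14DomainGeom.Within ν y z) :
    ∀ z ∈ T, z ∉ Ω → ∀ y, h z y ≠ 0 → y ∈ B14DomainGeom.seam s 1 ν Λ :=
  fun z hzT hzΩ y hy =>
    B14DomainGeom.mem_seam_of_within s 1 ν (fun hz0 => hzΩ (hΩ z hzT hz0)) (hsupp z y hy)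

/-- Likewise the hypothesis `hφS` of `diff_eq_zero_off_seam` from (2.24) AS PRINTED: `φ_j = 1` on `Λ_j^{∼−1} ⊇ Λ_j⁰ =
innerN s 1 Λ_j` (equality under the `MR_j`-cube reading of `∼`, proper inclusion under the `M`-cube reading, §E header;
`h224` asks `φ_j = 1` on `innerN s 1 Λ_j` only) ⟹ `φ_j = 1` off `seam s 1 ν Λ_j` (`ν ≥ 0`). [cite: Balaban1988Convergent, (2.24) p.259 ("φ_j = 1 on
Λ_j^{∼−1}"), p.263 ("the operation ∼ is in the corresponding scale")] -/
theorem eq_one_off_seam {d : ℕ} (s : ℕ) {ν : ℤ} (hν : 0 ≤ ν) (Λ : Set (B14DomainGeom.Pt d))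
    (φ : B14DomainGeom.Pt d → ℝ) (h224 : ∀ y ∈ B14DomainGeom.innerN s 1 Λ, φ y = 1) :
    ∀ y, y ∉ B14DomainGeom.seam s 1 ν Λ → φ y = 1 :=
  fun y hy => h224 y (B14DomainGeom.mem_innerN_of_not_mem_seam s 1 hν hy)

end Literature.MathematicalPhysics.QuantumFieldTheory.Balaban1983to89.B14Seam245
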